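import Summits.CriticalPhenomena.SAWScalingLimit.Theorems.SAWRenewalTightnessTubeLowerBoundSpanFloorOfBPD

/-!
# Sub-goal `spanRenewalFloor_vertex_of_word` of the line `subcritical-renewal-floor`
(crux `TubeLowerBound`, stmt-CriticalPhenomena-4730): the span-renewal floor, word form ⇒ vertex form

Kesten's span-renewal floor at the critical fugacity `x_c`, `S_N(L) ≥ c L^{-C}`, is proved in the word
model of `SAWWords.lean` / `SAWWordBridges.lean` (`spanRenewalFloor_of_breakPointDensity`, file
`SAWRenewalTightnessTubeLowerBoundSpanFloorOfBPD.lean`), where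
`S_N(L) = Σ_{n ≤ N} Σ_{w ∈ sawWords n, w a bridge word of span L} x_c^n`.  The planner's
`SpanRenewalFloor` and `bridgeSpanFloor_of_cornerCrossingFloor` use the vertex-function form
`Σ_{n ≤ N} Σ_{ω ∈ Zd.bridges 2 n, ω₁(n) = L} x_c^n` (`SAWBridges.lean`).  Here we transport the floor:
for each length `n` the map `w ↦ traj w` sends the self-avoiding bridge words of length `n` and span
`L` injectively into `{ω ∈ Zd.bridges 2 n : ω₁(n) = L}` (`traj_mem_bridges`; `xEnd w = traj w |w| 0`
by definition; injectivity `eq_of_traj_eq` of `SAWWords.lean`), both inner sums are constant sums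
`card • x_c^n`, so the word-form mass is at most the vertex-form mass, with the same `C, c, N`.
Together with the landed sibling this gives `spanRenewalFloor_of_breakPointDensity'`
(break-point density ⇒ the span-renewal floor in vertex form).

References: H. Kesten, *On the number of self-avoiding walks*, J. Math. Phys. 4 (1963), §4;
N. Madras, G. Slade, *The Self-Avoiding Walk* (1993), §1.1 (a walk is the sequence of its steps),
Definition 1.2.4 (bridges, span).
-/

noncomputable section

namespace Summit.CriticalPhenomena.SAWScalingLimit.Theorems.TubeLowerBound.SubcriticalRenewalFloor

open scoped BigOperators Classical
open Literature.Probability.LatticeModels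
open Literature.Probability.RandomPlanarGeometry Literature.Probability.RandomPlanarGeometry.SAW

namespace SpanFloorVertex

/-- The self-avoiding bridge words of length `n` and span `L` inject (by `traj`) into the
vertex-function bridges `Zd.bridges 2 n` of span `ω₁(n) = L`. [cite: MadrasSlade1993, §1.1] -/
theorem card_filter_le_card_bridges_filter (n : ℕ) (L : ℤ) :
    ((sawWords n).filter (fun w => IsBridgeW w ∧ xEnd w = L)).card ≤
      ((Zd.bridges 2 n).filter (fun ω => ω n 0 = L)).card := by
  refine Finset.card_le_card_of_injOn traj (fun w hw => ?_) ?_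
  · rw [Finset.mem_coe, Finset.mem_filter, mem_sawWords] at hw
    obtain ⟨⟨hl, hs⟩, hb, hx⟩ := hw
    rw [Finset.mem_coe, Finset.mem_filter]
    refine ⟨traj_mem_bridges hl hs hb, ?_⟩
    -- `xEnd w = xAt w |w| = traj w |w| 0` by definition, and `|w| = n`
    rw [← hl]
    exact hx
  · intro w hw w' hw' h
    rw [Finset.mem_coe, Finset.mem_filter, mem_sawWords] at hw hw'
    exact eq_of_traj_eq (hw.1.1.trans hw'.1.1.symm) h

/-- Per length `n`, the critical mass of the bridge words of span `L` is at most that of the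
vertex-function bridges of span `L` (both are `card • x_c^n`). [cite: MadrasSlade1993, §1.1] -/
theorem sum_filter_le_sum_bridges_filter (n : ℕ) (L : ℤ) :
    ∑ _w ∈ (sawWords n).filter (fun w => IsBridgeW w ∧ xEnd w = L), criticalFugacity ^ n ≤
      ∑ _ω ∈ (Zd.bridges 2 n).filter (fun ω => ω n 0 = L), criticalFugacity ^ n := by
  rw [Finset.sum_const, Finset.sum_const, nsmul_eq_mul, nsmul_eq_mul]
  exact mul_le_mul_of_nonneg_right (Nat.cast_le.2 (card_filter_le_card_bridges_filter n L))
    (pow_nonneg StripMass.criticalFugacity_pos.le _)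

end SpanFloorVertex

/-- **Span-renewal floor: word form ⇒ vertex form** (sub-goal `spanRenewalFloor_vertex_of_word` of
the line `subcritical-renewal-floor`).  If the critical mass of the self-avoiding bridge words of span
exactly `L` is `≥ c L^{-C}` (for some cut-off `N = N(L)`, all `L ≥ 1`), then so is the critical mass of
the vertex-function bridges `ω ∈ Zd.bridges 2 n`, `n ≤ N`, with `ω₁(n) = L`, with the same `C, c, N`:
`traj` injects the former into the latter length by length. [cite: MadrasSlade1993, Definition 1.2.4] -/
theorem spanRenewalFloor_vertex_of_word :
    (∃ C c : ℝ, 0 ≤ C ∧ 0 < c ∧ ∀ L : ℕ, 1 ≤ L → ∃ N : ℕ, c * (L : ℝ) ^ (-C) ≤ ∑ n ∈ Finset.range (N + 1), ∑ _w ∈ (sawWords n).filter (fun w => IsBridgeW w ∧ xEnd w = (L : ℤ)), criticalFugacity ^ n) → ∃ C c : ℝ, 0 ≤ C ∧ 0 < c ∧ ∀ L : ℕ, 1 ≤ L → ∃ N : ℕ, c * (L : ℝ) ^ (-C) ≤ ∑ n ∈ Finset.range (N + 1), ∑ _ω ∈ (Zd.bridges 2 n).filter (fun ω => ω n 0 =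 (L : ℤ)), criticalFugacity ^ n := by
  rintro ⟨C, c, hC, hc, h⟩
  refine ⟨C, c, hC, hc, fun L hL => ?_⟩
  obtain ⟨N, hN⟩ := h L hL
  exact ⟨N, hN.trans (Finset.sum_le_sum fun n _ =>
    SpanFloorVertex.sum_filter_le_sum_bridges_filter n (L : ℤ))⟩

/-- **Break-point density ⇒ Kesten's span-renewal floor, vertex form** (composite of the landed
`spanRenewalFloor_of_breakPointDensity` with `spanRenewalFloor_vertex_of_word`): if for some `c₀ > 0`
and every `D ≥ 1` the critical mass of the bridge words with span in `[D, 2D)` all of whose break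
points lie below level `D` is `≥ c₀`, then the critical mass of the vertex-function bridges of span
exactly `L` is `≥ c L^{-C}` for every `L ≥ 1`. [cite: Kesten1963SAW, §4] -/
theorem spanRenewalFloor_of_breakPointDensity' :
    (∃ c₀ : ℝ, 0 < c₀ ∧ ∀ D : ℕ, 1 ≤ D → ∃ N : ℕ, c₀ ≤ ∑ n ∈ Finset.range (N + 1), ∑ _w ∈ (sawWords n).filter (fun w => IsBridgeW w ∧ (D : ℤ) ≤ xEnd w ∧ xEnd w < 2 * (D : ℤ) ∧ ∀ j, IsBreak w j → xAt w j < (D : ℤ)), criticalFugacity ^ n) → ∃ C c : ℝ, 0 ≤ C ∧ 0 < c ∧ ∀ L : ℕ, 1 ≤ L → ∃ N : ℕ, c * (L : ℝ) ^ (-C) ≤ ∑ n ∈ Finset.range (N + 1), ∑ _ω ∈ (Zd.bridges 2 n).filter (fun ω => ω n 0 = (L : ℤ)), criticalFugacity ^ n :=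
  fun h => spanRenewalFloor_vertex_of_word (spanRenewalFloor_of_breakPointDensity h)

end Summit.CriticalPhenomena.SAWScalingLimit.Theorems.TubeLowerBound.SubcriticalRenewalFloor

end
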